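import Summits.QuantumFields.YangMills.Theorems.UnitScaleTiltProp7BondAvgIterCoercivity
import Literature.MathematicalPhysics.QuantumFieldTheory.Balaban1983to89.B5Eq118OneStroke
import HarnessLib

/-!
# Route `UnitScaleTilt`, crux K1 child «MinimiserStabilityRegPr» (stmt-QuantumFields-19200), stub `stub_prop7From14` (V3) — bookkeeping: the two tree
# presentations of [Balaban1984PropagatorsI] (1.18) AGREE — `B5Eq118OneStroke.iterBlock k y` (iterated `blockOf`, `segSum`) versus the `Site.proj k k`
# fibres and iterated unit shifts of `Prop7FlatCoercivity.bondAvgIter_eq_lineBlockAvg` (p454029)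

Cell `ym3-torus` ∕ fleet seat `ym-ust-19200-p1`.  DEDUP NOTE.  The one-stroke formula (1.18) for `LatticeFieldCalculus.bondAvgIter k` was already in the
tree as `B5Eq118OneStroke.bondAvgIter_eq_blockSum` (blocks `iterBlock k y`, contour sums `segSum`); p454029 re-derived it over the fibres
`{x : Site.proj k k x = y}` of `B1RG242Torus` and the iterated unit shifts, the form consumed by the flat coercivity `Prop7FlatCoercivity.sum_sq_le_lineBlockAvg_add_grad`
(p451004).  This file records the dictionary between the two presentations so that either can be cited for the other: `iterBlock_eq_filter_proj`
(the blocks coincide in the standing range) and `segSum_eq_sum_iterate_shift` (the contour sums coincide), whence `bondAvgIter_eq_blockSum` ⇒ p454029's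
form (`bondAvgIter_eq_lineBlockAvg_of_eq118`).  Sorry-free, no definition, [folklore].

References: T. Bałaban, CMP 95 (1984) 17–40 [Balaban1984PropagatorsI] ((1.6) p.18, (1.8) p.19, (1.18) p.20).
-/

noncomputable section

open scoped BigOperators

namespace Summit.QuantumFields.YangMills.Theorems.Prop7FlatCoercivity

open Literature.MathematicalPhysics.QuantumFieldTheory.Balaban1983to89
open Finset LatticeFieldCalculus B1RG242Torus B5Eq118OneStroke

variable {P : Params}

/-- **THE BLOCKS COINCIDE**: in the standing range, `B5Eq118OneStroke.iterBlock k y` is the fibre `{x : Site.proj k k x = y}` of `B1RG242Torus`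
(both are «label div `L^k` = label of `y`», [Balaban1984PropagatorsI] (1.6)). [cite: Balaban1984PropagatorsI, (1.6) p.18] -/
theorem iterBlock_eq_filter_proj {k : ℕ} (hk : k ≤ P.m + P.K) (y : Site P k) :
    iterBlock k y = univ.filter (fun x : Site P 0 => Site.proj k k x = y) := by
  have h0k : P.sitesPerDir 0 = P.L ^ k * P.sitesPerDir k := sitesPerDir_zero_eq_pow_mul hk
  ext x
  rw [mem_iterBlock_iff hk, Finset.mem_filter]
  simp only [Finset.mem_univ, true_and]
  constructor
  · intro h
    funext μ
    apply ZMod.val_injective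
    rw [Site.val_proj h0k]
    exact h μ
  · intro h μ
    rw [← h, Site.val_proj h0k]

/-- **THE CONTOUR SUMS COINCIDE**: `segSum A x μ n = Σ_{t<n} A(⟨x + t e_μ, μ⟩)` with `x + t e_μ` the `t`-fold unit shift. [cite: Balaban1984PropagatorsI, (1.8) p.19] -/
theorem segSum_eq_sum_iterate_shift {j : ℕ} {V : Type*} [AddCommGroup V] [Module ℝ V] (A : VecField P j V) (x : Site P j) (μ : Fin P.d) (n : ℕ) :
    segSum A x μ n = ∑ t ∈ range n, A ⟨(fun z : Site P j => z.shift μ)^[t] x, μ⟩ := by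
  simp only [segSum, runBond, iterate_shift_eq_runSite]

/-- p454029's one-stroke form DERIVED from the tree's `B5Eq118OneStroke.bondAvgIter_eq_blockSum` through the dictionary (consistency of the two
presentations of (1.18)). [cite: Balaban1984PropagatorsI, (1.18) p.20] -/
theorem bondAvgIter_eq_lineBlockAvg_of_eq118 {V : Type*} [AddCommGroup V] [Module ℝ V] {k : ℕ} (hk : k ≤ P.m + P.K)
    (X : VecField P 0 V) (c : PBond P k) :
    bondAvgIter k X c = ((((P.L : ℝ) ^ k) ^ P.d * (P.L : ℝ) ^ k)⁻¹) •
      ∑ x ∈ univ.filter (fun x : Site P 0 => Site.proj k k x = c.src),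
        ∑ t ∈ range (P.L ^ k), X ⟨(fun z : Site P 0 => z.shift c.dir)^[t] x, c.dir⟩ := by
  rw [bondAvgIter_eq_blockSum k hk X c, iterBlock_eq_filter_proj hk]
  simp only [segSum_eq_sum_iterate_shift]
  congr 1
  rw [← pow_mul, ← pow_mul, ← pow_add, show (P.d + 1) * k = k * P.d + k by ring]

end Summit.QuantumFields.YangMills.Theorems.Prop7FlatCoercivity

end
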